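import Summits.HodgeConjecture.HodgeConjecture.Theorems.R90S6OrbitNcardCoverGlue      -- ★ glue `orbit_mem_of_ncard_eq_of_cover_of_injective`
import Summits.HodgeConjecture.HodgeConjecture.Theorems.R90S6CartanExhaustionU3       -- ★ W8-a `exists_mem_orbit_torusGen_pow_three`
import Summits.HodgeConjecture.HodgeConjecture.Theorems.R90S6CartanShellSphere        -- ★ W7-i `ncard_orbit_torusGen_pow_injective_inert`
import HarnessLib

/-!
# R90 · S6 «Ch. 14.1–14.5 stable trace formula» — WAVE 8 card W8-c′: THE PAYER `hsep` AT AN INERT PLACE, `N = 3`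
# (`Theorems/R90S6IndexSeparatesU3Inert.lean`; the index `#(K₀ g K₀ ∕ K₀)` separates the `K₀`-double cosets of `U(σ_w, J₀)(E_w)`)

Cell `hodgecm-mathlib`, crux H413 (`stmt-HodgeConjecture-24833`), route of record `HCCMUnconditional`; programme R90-TF, section S6
(base `R90-C14`), seat R90-C14-p06 (g0); S6 DEAL «WAVE 8 + W7-h + TOKENS» (R90-C14-plan (g2), R90 bus 2026-09-04T23:34:54Z) + RULING (2)
23:38:35Z «W8-c′ TAKEN: typ2's addendum target `mem_orbit_of_ncard_orbit_eq_inert` 84f71ff5a819d325 IS p06 (g0)'s second form of record →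
`Theorems/R90S6IndexSeparatesU3Inert.lean`».  Statement VERBATIM from the addendum
`R90/R90-C14-typ2/g2/S6_wave8_addendum_W8c_inert.v1.84f71ff5a819d325.lean` :50–:64 (namespace `…R90.S6`, the sheet's `.Wave8` dropped; the
`section InertPlace` binders `(c : E ≃ₐ[F] E) (v : HeightOneSpectrum (𝓞 F))` = p07's, so the letter composes BY NAME).  Helper lane
`--supports stmt-HodgeConjecture-24833 --as helper`; THEOREMS ONLY (no definition, no instance, no notation, no named fact, no `sorry`); imports =
the three ★ S6 Theorems modules named above + HarnessLib (no Lines import).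

CONTENT.  At an inert place `w ∣ v` of a quadratic extension `E ∕ F` of number fields (`v` unramified in `E`, `c • w = w`, `σ_w = galAdicCompletionMap c hw`,
`U = U(σ_w, J₀)(E_w)`, `J₀ = antidiag(1,1,1)`, `K₀ = unitaryInt`, any unramified datum `hd`, `t = hd.torusGen = diag(ϖ, 1, ϖ⁻¹)`): the Cartan
shells `K₀ tᵐ K₀` COVER `U` (★ W8-a, Bruhat–Tits (4.4.3)) and their indices `#(K₀ tᵐ K₀ ∕ K₀)` (`1`, `(q_v³+1)·q_v^m·(q_v³)^{m−1}`) are PAIRWISE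
DISTINCT in `m` (★ p07 `ncard_orbit_torusGen_pow_injective_inert`, Bruhat–Tits (4.4.4) via the lattice tree); hence, by the ★ glue
`orbit_mem_of_ncard_eq_of_cover_of_injective`, equal index ⇒ same double coset.  This is the letter `hsep` of ★ W7-a.3
`mk_mulEquiv_mem_orbit_of_ncard_separates` ∕ ★ W7-a.4 `coeff_toVector_comp_eq_of_memLaw` («eG-independence») at the on-path pair
`(U(J₀,3)(E_w), K₀)`: `hsep := mem_orbit_of_ncard_orbit_eq_inert c v hc hv w hw hd`.  ONE TERM.

* **`mem_orbit_of_ncard_orbit_eq_inert`** — W8-c′.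

HONEST LABEL: a helper theorem, count-neutral until the E1.3.9 assembly consumes it through W7-a.4; HC_CM is proved only modulo the 7 printed
citations (2 remaining named inputs: hLiu418 = stmt-HodgeConjecture-24832, h413 = stmt-HodgeConjecture-24833) until rung 0 closes; REL ≠ ★ ≠ BUILT.

## References
* [BruhatTits1972] F. Bruhat, J. Tits, *Groupes réductifs sur un corps local I*, Publ. IHÉS 41 (1972), (4.4.3) (Cartan decomposition),
  (4.4.4) (indices of the shells).
* [Tits1979] J. Tits, *Reductive groups over local fields*, PSPM 33.1 (1979), §2.4, §3.3.3.
-/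

set_option autoImplicit false
-- the mandated namespace repeats the single-problem summit's segment (`HodgeConjecture.HodgeConjecture`)
set_option linter.dupNamespace false

noncomputable section

open scoped Valued WithZero Matrix MatrixGroups

open Literature.NumberTheory.Automorphic Literature.NumberTheory.Automorphic.HermitianLattice
  Literature.NumberTheory.Automorphic.UnitaryLatticeTree Literature.NumberTheory.Automorphic.CartanUnique
  Literature.NumberTheory.Automorphic.SymplecticCartan

namespace Summit.HodgeConjecture.HodgeConjecture.R90.S6

section InertPlace

open _root_.NumberField _root_.IsDedekindDomain Literature.NumberTheory.Automorphic.UnitaryGroup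

variable {F E : Type} [Field F] [NumberField F] [Field E] [NumberField E] [Algebra F E] [Algebra.IsQuadraticExtension F E]
  (c : E ≃ₐ[F] E) (v : HeightOneSpectrum (𝓞 F))

/-- **W8-c′ THE PAYER `hsep` AT AN INERT PLACE, `N = 3`**: the index `#(K₀ g K₀ ∕ K₀)` SEPARATES the `K₀`-double cosets of `U(σ_w, J₀)(E_w)` —
in the letters of W7-a.3 (`mk_mulEquiv_mem_orbit_of_ncard_separates`: `hsep := mem_orbit_of_ncard_orbit_eq_inert c v hc hv w hw hd`).  The glue
`orbit_mem_of_ncard_eq_of_cover_of_injective` at the Cartan shells `m ↦ tᵐ`: they cover `U` (★ W8-a `exists_mem_orbit_torusGen_pow_three`) and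
their indices are pairwise distinct (★ `ncard_orbit_torusGen_pow_injective_inert`). [cite: BruhatTits1972, (4.4.3), (4.4.4)] [cite: Tits1979, §2.4, §3.3.3] -/
theorem mem_orbit_of_ncard_orbit_eq_inert (hc : c ≠ 1) (hv : Algebra.IsUnramifiedIn (𝓞 E) v.asIdeal) (w : UnitaryGroup.PlacesOver E v)
    (hw : c • w.1 = w.1) {ϖ : w.1.adicCompletion E} (hd : UnramifiedLocalConjDatum (galAdicCompletionMap (L := E) c hw) ϖ)
    (g g' : ↥(unitaryGroupOfForm (galAdicCompletionMap (L := E) c hw) ((StdForm.antidiagonal 3).over (w.1.adicCompletion E))))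
    (h : (MulAction.orbit (unitaryInt (galAdicCompletionMap (L := E) c hw) ((StdForm.antidiagonal 3).over (w.1.adicCompletion E)))
          (g : ↥(unitaryGroupOfForm (galAdicCompletionMap (L := E) c hw) ((StdForm.antidiagonal 3).over (w.1.adicCompletion E))) ⧸
            unitaryInt (galAdicCompletionMap (L := E) c hw) ((StdForm.antidiagonal 3).over (w.1.adicCompletion E)))).ncard =
        (MulAction.orbit (unitaryInt (galAdicCompletionMap (L := E) c hw) ((StdForm.antidiagonal 3).over (w.1.adicCompletion E)))
          (g' : ↥(unitaryGroupOfForm (galAdicCompletionMap (L := E) c hw) ((StdForm.antidiagonal 3).over (w.1.adicCompletion E))) ⧸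
            unitaryInt (galAdicCompletionMap (L := E) c hw) ((StdForm.antidiagonal 3).over (w.1.adicCompletion E)))).ncard) :
    (g' : ↥(unitaryGroupOfForm (galAdicCompletionMap (L := E) c hw) ((StdForm.antidiagonal 3).over (w.1.adicCompletion E))) ⧸
        unitaryInt (galAdicCompletionMap (L := E) c hw) ((StdForm.antidiagonal 3).over (w.1.adicCompletion E))) ∈
      MulAction.orbit (unitaryInt (galAdicCompletionMap (L := E) c hw) ((StdForm.antidiagonal 3).over (w.1.adicCompletion E)))
        (g : ↥(unitaryGroupOfForm (galAdicCompletionMap (L := E) c hw) ((StdForm.antidiagonal 3).over (w.1.adicCompletion E))) ⧸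
          unitaryInt (galAdicCompletionMap (L := E) c hw) ((StdForm.antidiagonal 3).over (w.1.adicCompletion E))) :=
  orbit_mem_of_ncard_eq_of_cover_of_injective
    (unitaryInt (galAdicCompletionMap (L := E) c hw) ((StdForm.antidiagonal 3).over (w.1.adicCompletion E)))
    (fun m : ℕ => hd.torusGen ^ m) (fun u => exists_mem_orbit_torusGen_pow_three hd u)
    (ncard_orbit_torusGen_pow_injective_inert c v hc hv w hw hd) h

end InertPlace

end Summit.HodgeConjecture.HodgeConjecture.R90.S6

end
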